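import Literature.Probability.Percolation.KozmaNitzanGoodQuadruple
import Summits.CriticalPhenomena.PercolationContinuityZ3.Theorems.PercNearOneGluingNoHeavyLowerTailProdWeightPivot
import HarnessLib

/-!
# One pair weight: affinity of cylinder probabilities, the separations a new pair destroys, and the BHK covariance inequality NC

Support file for crux `stmt-CriticalPhenomena-4575` (`NoHeavyLowerTail`), seat `prim-facecert` gen 20
(`--supports stmt-CriticalPhenomena-4575`; all-graphs `(Q6)_port`/`(C½)` programme, paper proof prim-l12-p1 gen 22, memo
`run/shared/lean/prim/prim-l12/FROM-prim-l12-p1-g22-CHALF-ALL-GRAPHS.md` §8, check by prim-facecert gen 20).  No definitions, no sorries.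

Bernoulli percolation `μ_w = prodBernoulli w` on a finite vertex type, arbitrary pair weights; `{x ↔ y} = openConn x y`.
* `real_update_eq`, `real_update_zero_sub_one` (the weight-`1` / affine forms are the tree's `FK.real_update_one_eq_real_update_zero_insert` and `HubOnly.Refresh.IsoFive.real_update_affine`; consumers derive them locally from `real_update_eq`) — the probability of ANY event is affine
  in the weight of one pair `e`: `P_{w[e↦r]}(A) = (1−r)·P_{w[e↦0]}(A) + r·P_{w[e↦1]}(A)`, and for a decreasing `A` the decrement is
  the probability of `A ∖ {ω ∪ {e} ∈ A}` (one-coordinate pivot of `…ProdWeightPivot`).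
* `reachable_insert_iff` — reachability after adding one pair `s(c,x)`; `isoA_diff_insert`, `sep_diff_insert` — on `{a ↮ b, a ↮ c}`
  the new pair `s(c,x)` destroys the isolation of `a` iff `a ↔ x`; on `{a|b|c}` it destroys the pairwise separation iff `a ↔ x` or `b ↔ x`.
* **`nc`** — for `x, b, c ≠ a` and `D = {a ↮ b} ∩ {a ↮ c}`:  `P(D, a↔x)·P(D, b↮c) ≤ P(D)·P(D, a↔x, b↮c)` — given `a ↮ {b,c}`,
  the events `{a ↔ x}` and `{b ↮ c}` are positively correlated.  This is van den Berg–Häggström–Kahn 2006, Thm. 1.3 (PROVED in the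
  tree: `BHK2006_clusterConditionalPositiveAssociation_holds`) for `s = a`, `X = {b,c}` and the increasing cluster functions
  `1[x ∈ V(C_a)]`, `W ↦ P_{G−V(W)}(b ↮ c)`, combined with the spatial Markov property
  `P(C(a) = W, b ↔ c) = P(C(a) = W)·P_{G∖W}(b ↔ c)` (`KNGoodAux.real_clusterIs_inter_openConn`).  It is step `NC₀` of the
  all-graphs proof of `(Q6)_port`; the companion inequality at weight `1` (`NC₁`) reduces to `NC₀` by monotonicity
  (`ThreePointIsoSexticChord.sextic_chord_of_cov`). [cite: VandenbergHaggstromKahn2005, Thm. 1.3 (p. 6)]; [cite: Grimmett1999, §2.2, §2.4]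
-/

noncomputable section

namespace Summit.CriticalPhenomena.PercolationContinuityZ3.Theorems.ThreePointIsoSexticEdgeNC

open MeasureTheory Set
open Literature.Probability.Percolation Literature.Probability.Percolation.BHK2006
open Literature.Probability.LatticeModels (prodBernoulli)
open Summit.CriticalPhenomena.PercolationContinuityZ3.Theorems.ProdWeightPivot
open scoped Classical
/-! ## One pair weight: cylinder probabilities are affine -/

section Affine

variable {V : Type*} [Fintype V]

omit [Fintype V] in
/-- Coercion of an updated weight function. [folklore] -/
theorem coe_update (w : Sym2 V → unitInterval) (e : Sym2 V) (r : unitInterval) :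
    (fun i => ((Function.update w e r i : unitInterval) : ℝ)) = Function.update (fun i => (w i : ℝ)) e (r : ℝ) := by
  funext i
  by_cases h : i = e
  · subst h; simp
  · simp [Function.update_of_ne h]

/-- **One-pair pivot at the level of `prodBernoulli`**: for every event `A`,
`P_{w[e↦r]}(A) = (1 − r)·P_{w[e↦0]}(A) + r·P_{w[e↦0]}(ω ∪ {e} ∈ A)`. [folklore; Grimmett 1999 §2.4 (Russo/Margulis conditioning on one edge)] -/
theorem real_update_eq (w : Sym2 V → unitInterval) (e : Sym2 V) (r : unitInterval) (A : Set (BondConfig V)) :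
    (prodBernoulli (Function.update w e r)).real A =
      (1 - (r : ℝ)) * (prodBernoulli (Function.update w e 0)).real A +
        (r : ℝ) * (prodBernoulli (Function.update w e 0)).real {ω | insert e ω ∈ A} := by
  rw [real_eq_sum_weight _ MeasurableSet.of_discrete, real_eq_sum_weight _ MeasurableSet.of_discrete,
    real_eq_sum_weight _ MeasurableSet.of_discrete, coe_update, coe_update,
    sum_weight_pivot (Function.update (fun i => (w i : ℝ)) e (r : ℝ)) e]
  have h0 : ((0 : unitInterval) : ℝ) = 0 := rfl
  -- the outer update produced by the pivot lemma carries the classical instance; identify it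
  have hb : ∀ (inst inst' : DecidableEq (Sym2 V)) (W : Sym2 V → ℝ) (s t : ℝ),
      @Function.update _ _ inst (@Function.update _ _ inst' W e s) e t = @Function.update _ _ inst' W e t := by
    intro inst inst' W s t; funext k
    unfold Function.update
    by_cases hk : k = e
    · subst hk; rw [dif_pos rfl, dif_pos rfl]
    · rw [dif_neg hk, dif_neg hk, dif_neg hk]
  rw [hb, Function.update_self, h0]
  set w₀ := Function.update (fun i => (w i : ℝ)) e (0 : ℝ) with hw₀
  have step : ∑ ω, weight w₀ ω * ((1 - (r : ℝ)) * (if ω \ {e} ∈ A then (1 : ℝ) else 0) +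
      (r : ℝ) * (if insert e ω ∈ A then (1 : ℝ) else 0)) =
      ∑ ω, weight w₀ ω * ((1 - (r : ℝ)) * (if ω ∈ A then (1 : ℝ) else 0) +
      (r : ℝ) * (if insert e ω ∈ A then (1 : ℝ) else 0)) := by
    refine sum_weight_congr fun ω hω => ?_
    have he : e ∉ ω := fun h => hω (Finset.prod_eq_zero (Finset.mem_univ e) (by simp [h, hw₀]))
    have : ω \ {e} = ω := by ext k; by_cases hk : k = e <;> simp [hk, he]
    rw [this]
  rw [step]
  simp only [mul_add, Finset.sum_add_distrib]
  congr 1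
  · rw [Finset.mul_sum]; refine Finset.sum_congr rfl fun ω _ => ?_; ring
  · rw [Finset.mul_sum]; refine Finset.sum_congr rfl fun ω _ => ?_
    simp only [mem_setOf_eq]; ring

/-- For a DECREASING event the value at weight `1` is the value at weight `0` minus the probability of being pivotal:
`P_{w[e↦0]}(A) − P_{w[e↦1]}(A) = P_{w[e↦0]}(A ∖ {ω | ω ∪ {e} ∈ A})`. [folklore] -/
theorem real_update_zero_sub_one (w : Sym2 V → unitInterval) (e : Sym2 V) {A : Set (BondConfig V)} (hA : IsLowerSet A) :
    (prodBernoulli (Function.update w e 0)).real A - (prodBernoulli (Function.update w e 1)).real A =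
      (prodBernoulli (Function.update w e 0)).real (A \ {ω | insert e ω ∈ A}) := by
  have h1 := real_update_eq w e 1 A
  simp only [Set.Icc.coe_one, sub_self, zero_mul, zero_add, one_mul] at h1
  rw [h1]
  have hsub : {ω : BondConfig V | insert e ω ∈ A} ⊆ A := fun ω hω => hA (subset_insert e ω) hω
  rw [measureReal_sdiff hsub MeasurableSet.of_discrete]
end Affine

/-! ## Adding one pair: which separations it destroys -/

section AddEdge

variable {V : Type*}

/-- **Reachability after adding one pair** `s(c,x)`: `p ↔ q` in `ω ∪ {s(c,x)}` iff `p ↔ q` in `ω`, or `p ↔ c` and `x ↔ q`, or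
`p ↔ x` and `c ↔ q` (in `ω`). [folklore] -/
theorem reachable_insert_iff {ω : BondConfig V} {c x : V} (p q : V) :
    (openGraph (insert s(c, x) ω)).Reachable p q ↔
      (openGraph ω).Reachable p q ∨ ((openGraph ω).Reachable p c ∧ (openGraph ω).Reachable x q) ∨
        ((openGraph ω).Reachable p x ∧ (openGraph ω).Reachable c q) := by
  constructor
  · rintro ⟨walk⟩
    -- induction on the walk, keeping the three-way disjunction
    induction walk with
    | nil => exact Or.inl (SimpleGraph.Reachable.refl _)
    | @cons p p' q' hadj _ ih =>
      rw [openGraph_adj] at hadj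
      obtain ⟨hmem, hne⟩ := hadj
      have hmono : ∀ {y z : V}, (openGraph ω).Reachable y z → (openGraph ω).Reachable y z := id
      rcases (mem_insert_iff.1 hmem) with heq | hω
      · -- the step uses the new pair: `{p, p'} = {c, x}`
        rcases Sym2.eq_iff.1 heq with ⟨rfl, rfl⟩ | ⟨rfl, rfl⟩
        · -- p = c, p' = x
          rcases ih with h | ⟨h1, h2⟩ | ⟨h1, h2⟩
          · exact Or.inr (Or.inl ⟨SimpleGraph.Reachable.refl _, h⟩)
          · exact Or.inr (Or.inl ⟨SimpleGraph.Reachable.refl _, h2⟩)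
          · exact Or.inl h2
        · -- p = x, p' = c
          rcases ih with h | ⟨h1, h2⟩ | ⟨h1, h2⟩
          · exact Or.inr (Or.inr ⟨SimpleGraph.Reachable.refl _, h⟩)
          · exact Or.inl h2
          · exact Or.inr (Or.inr ⟨SimpleGraph.Reachable.refl _, h2⟩)
      · have hpp' : (openGraph ω).Reachable p p' := SimpleGraph.Adj.reachable ((openGraph_adj ω p p').2 ⟨hω, hne⟩)
        rcases ih with h | ⟨h1, h2⟩ | ⟨h1, h2⟩
        · exact Or.inl (hpp'.trans h)
        · exact Or.inr (Or.inl ⟨hpp'.trans h1, h2⟩)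
        · exact Or.inr (Or.inr ⟨hpp'.trans h1, h2⟩)
  · have hmono : openGraph ω ≤ openGraph (insert s(c, x) ω) := openGraph_mono (subset_insert _ _)
    by_cases hcx : c = x
    · subst hcx
      rintro (h | ⟨h1, h2⟩ | ⟨h1, h2⟩)
      · exact h.mono hmono
      · exact (h1.trans h2).mono hmono
      · exact (h1.trans h2).mono hmono
    · have hadj : (openGraph (insert s(c, x) ω)).Reachable c x :=
        SimpleGraph.Adj.reachable ((openGraph_adj _ c x).2 ⟨mem_insert _ _, hcx⟩)
      rintro (h | ⟨h1, h2⟩ | ⟨h1, h2⟩)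
      · exact h.mono hmono
      · exact ((h1.mono hmono).trans hadj).trans (h2.mono hmono)
      · exact ((h1.mono hmono).trans hadj.symm).trans (h2.mono hmono)

/-- **Isolation of `a` from `{b,c}`, and the new pair `s(c,x)`**: on `{a ↮ b, a ↮ c}`, adding `s(c,x)` destroys the isolation
of `a` iff `a ↔ x`. [this work] -/
theorem isoA_diff_insert (a b c x : V) :
    ((openConn a b)ᶜ ∩ (openConn a c)ᶜ : Set (BondConfig V)) \
        {ω | insert s(c, x) ω ∈ ((openConn a b)ᶜ ∩ (openConn a c)ᶜ : Set (BondConfig V))} =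
      (openConn a b)ᶜ ∩ (openConn a c)ᶜ ∩ openConn a x := by
  have moc : ∀ {ω : BondConfig V} {p q : V}, ω ∈ openConn p q ↔ (openGraph ω).Reachable p q := Iff.rfl
  ext ω
  simp only [mem_sdiff, mem_inter_iff, mem_compl_iff, mem_setOf_eq, moc, reachable_insert_iff]
  constructor
  · rintro ⟨⟨hab, hac⟩, h⟩
    refine ⟨⟨hab, hac⟩, ?_⟩
    by_contra hax
    apply h
    constructor
    · rintro (h1 | ⟨h1, -⟩ | ⟨h1, -⟩) <;> [exact hab h1; exact hac h1; exact hax h1]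
    · rintro (h1 | ⟨h1, -⟩ | ⟨h1, -⟩) <;> [exact hac h1; exact hac h1; exact hax h1]
  · rintro ⟨⟨hab, hac⟩, hax⟩
    refine ⟨⟨hab, hac⟩, fun h => h.2 (Or.inr (Or.inr ⟨hax, SimpleGraph.Reachable.refl _⟩))⟩

/-- **Pairwise separation and the new pair `s(c,x)`**: on `{a|b|c}`, adding `s(c,x)` destroys the pairwise separation iff
`a ↔ x` or `b ↔ x`. [this work] -/
theorem sep_diff_insert (a b c x : V) :
    ((openConn a b)ᶜ ∩ (openConn a c)ᶜ ∩ (openConn b c)ᶜ : Set (BondConfig V)) \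
        {ω | insert s(c, x) ω ∈ ((openConn a b)ᶜ ∩ (openConn a c)ᶜ ∩ (openConn b c)ᶜ : Set (BondConfig V))} =
      (openConn a b)ᶜ ∩ (openConn a c)ᶜ ∩ (openConn b c)ᶜ ∩ (openConn a x ∪ openConn b x) := by
  have moc : ∀ {ω : BondConfig V} {p q : V}, ω ∈ openConn p q ↔ (openGraph ω).Reachable p q := Iff.rfl
  ext ω
  simp only [mem_sdiff, mem_inter_iff, mem_compl_iff, mem_union, mem_setOf_eq, moc, reachable_insert_iff]
  constructor
  · rintro ⟨⟨⟨hab, hac⟩, hbc⟩, h⟩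
    refine ⟨⟨⟨hab, hac⟩, hbc⟩, ?_⟩
    by_contra hx
    rw [not_or] at hx
    obtain ⟨hax, hbx⟩ := hx
    apply h
    refine ⟨⟨?_, ?_⟩, ?_⟩
    · rintro (h1 | ⟨h1, -⟩ | ⟨h1, -⟩) <;> [exact hab h1; exact hac h1; exact hax h1]
    · rintro (h1 | ⟨h1, -⟩ | ⟨h1, -⟩) <;> [exact hac h1; exact hac h1; exact hax h1]
    · rintro (h1 | ⟨h1, -⟩ | ⟨h1, -⟩) <;> [exact hbc h1; exact hbc h1; exact hbx h1]
  · rintro ⟨⟨⟨hab, hac⟩, hbc⟩, hx⟩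
    refine ⟨⟨⟨hab, hac⟩, hbc⟩, fun h => ?_⟩
    rcases hx with hax | hbx
    · exact h.1.2 (Or.inr (Or.inr ⟨hax, SimpleGraph.Reachable.refl _⟩))
    · exact h.2 (Or.inr (Or.inr ⟨hbx, SimpleGraph.Reachable.refl _⟩))
end AddEdge

/-! ## The covariance inequality NC: given `a ↮ {b,c}`, the events `a ↔ x` and `b ↮ c` are positively correlated -/

section NC

variable {V : Type*} [Fintype V]

omit [Fintype V] in
/-- The vertex set of the open edge cluster of `a`, together with `a`, is the open (vertex) cluster of `a`. [folklore] -/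
theorem insert_vertices_openEdgeCluster (ω : BondConfig V) (a : V) :
    insert a {y | ∃ e ∈ openEdgeCluster ω a, y ∈ e} = openCluster ω a := by
  ext y
  rw [mem_insert_iff, mem_setOf_eq]
  change _ ↔ (openGraph ω).Reachable a y
  rw [reachable_iff_exists_mem_openEdgeCluster ω a y]

/-- `{a ↮ b, a ↮ c}` is the disjoint union, over the vertex sets `W ∌ b, c`, of the events `{C(a) = W}`. [folklore] -/
theorem isoA_eq_biUnion (a b c : V) :
    ((openConn a b)ᶜ ∩ (openConn a c)ᶜ : Set (BondConfig V)) =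
      ⋃ W ∈ KNGoodAux.nullSets ({b, c} : Finset V), clusterIs a W := by
  ext ω
  simp only [mem_inter_iff, mem_compl_iff, openConn, mem_setOf_eq, mem_iUnion, exists_prop]
  constructor
  · rintro ⟨hab, hac⟩
    refine ⟨(openCluster ω a).toFinite.toFinset, ?_, ?_⟩
    · rw [KNGoodAux.mem_nullSets, Finset.disjoint_left]
      intro y hy hy'
      rw [Set.Finite.mem_toFinset] at hy
      rcases Finset.mem_insert.1 hy' with rfl | hy'
      · exact hab hy
      · rw [Finset.mem_singleton] at hy'; subst hy'; exact hac hy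
    · rw [mem_clusterIs, Set.Finite.coe_toFinset]
  · rintro ⟨W, hW, hC⟩
    rw [KNGoodAux.mem_nullSets, Finset.disjoint_left] at hW
    rw [mem_clusterIs] at hC
    constructor
    · intro h; have : b ∈ openCluster ω a := h; rw [hC] at this; exact hW this (by simp)
    · intro h; have : c ∈ openCluster ω a := h; rw [hC] at this; exact hW this (by simp)

/-- **Integrating a function of the cluster of `a` over `{a ↮ b, a ↮ c}`**: sum over the clusters `W ∌ b, c`. [folklore] -/
theorem setIntegral_isoA_eq_sum (μ : Measure (BondConfig V)) [IsFiniteMeasure μ] (a b c : V) (φ : BondConfig V → ℝ)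
    (ψ : Finset V → ℝ) (hφ : ∀ W ω, ω ∈ clusterIs a W → φ ω = ψ W) :
    ∫ ω in ((openConn a b)ᶜ ∩ (openConn a c)ᶜ : Set (BondConfig V)), φ ω ∂μ =
      ∑ W ∈ KNGoodAux.nullSets ({b, c} : Finset V), ψ W * μ.real (clusterIs a W) := by
  rw [isoA_eq_biUnion a b c, integral_biUnion_finset _ (fun W _ => MeasurableSet.of_discrete)
    (fun W _ W' _ hne => pairwise_disjoint_clusterIs a hne) (fun W _ => (Integrable.of_finite).integrableOn)]
  refine Finset.sum_congr rfl fun W _ => ?_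
  rw [setIntegral_congr_fun MeasurableSet.of_discrete (fun ω hω => hφ W ω hω), setIntegral_const, smul_eq_mul, mul_comm]

/-- **NC (conditional positive correlation of `{a ↔ x}` and `{b ↮ c}` given `a ↮ {b,c}`).**  For every finite weighted
graph and vertices `a, b, c, x` with `x ≠ a`, `b ≠ a`, `c ≠ a`, writing `D = {a ↮ b} ∩ {a ↮ c}`:
`P(D ∩ {a ↔ x}) · P(D ∩ {b ↮ c}) ≤ P(D) · P(D ∩ {a ↔ x} ∩ {b ↮ c})`.
Proof: van den Berg–Häggström–Kahn 2006 Thm 1.3 (`BHK2006_clusterConditionalPositiveAssociation_holds`, PROVED in the tree)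
with `s = a`, `X = {b,c}` and the two increasing functions of the open edge cluster `C_a`: `1[x ∈ V(C_a)]` and
`W ↦ P_{G − V(W)}(b ↮ c)`; the spatial Markov property `P(C(a) = W, b ↔ c) = P(C(a) = W)·P_{G∖W}(b ↔ c)`
(`KNGoodAux.real_clusterIs_inter_openConn`) converts the integrals into the displayed probabilities.  This is the step
`(T_a)(0) = NC₀` of prim-l12-p1 gen 22's proof of `(Q6)_port` for all graphs. [this work] -/
theorem nc (w : Sym2 V → unitInterval) {a b c x : V} (hxa : x ≠ a) (hba : b ≠ a) (hca : c ≠ a) :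
    (prodBernoulli w).real ((openConn a b)ᶜ ∩ (openConn a c)ᶜ ∩ openConn a x) *
        (prodBernoulli w).real ((openConn a b)ᶜ ∩ (openConn a c)ᶜ ∩ (openConn b c)ᶜ) ≤
      (prodBernoulli w).real ((openConn a b)ᶜ ∩ (openConn a c)ᶜ) *
        (prodBernoulli w).real ((openConn a b)ᶜ ∩ (openConn a c)ᶜ ∩ openConn a x ∩ (openConn b c)ᶜ) := by
  have moc : ∀ {ω : BondConfig V} {p q : V}, ω ∈ openConn p q ↔ (openGraph ω).Reachable p q := Iff.rfl
  have haX : a ∉ ({b, c} : Set V) := by simp [hba.symm, hca.symm]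
  have hDX : {ω : BondConfig V | ∀ y ∈ ({b, c} : Set V), ¬ (openGraph ω).Reachable a y} =
      ((openConn a b)ᶜ ∩ (openConn a c)ᶜ : Set (BondConfig V)) := by
    ext ω; simp [moc]
  have hDX' : {ω : BondConfig V | ∀ y ∈ ({b, c} : Finset V), ¬ (openGraph ω).Reachable a y} =
      ((openConn a b)ᶜ ∩ (openConn a c)ᶜ : Set (BondConfig V)) := by
    ext ω; simp [moc]
  -- the two increasing functions of the edge cluster
  set F : Set (Sym2 V) → ℝ := fun C => if ∃ e ∈ C, x ∈ e then 1 else 0 with hF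
  set G : Set (Sym2 V) → ℝ := fun C =>
    (prodBernoulli w).real (openConnIn (insert a {y | ∃ e ∈ C, y ∈ e})ᶜ b c)ᶜ with hG
  have hFm : Monotone F := by
    intro C C' hCC'
    simp only [hF]
    by_cases h : ∃ e ∈ C, x ∈ e
    · obtain ⟨e, he, hxe⟩ := h
      rw [if_pos ⟨e, he, hxe⟩, if_pos ⟨e, hCC' he, hxe⟩]
    · rw [if_neg h]; split_ifs <;> norm_num
  have hGm : Monotone G := by
    intro C C' hCC'
    simp only [hG]
    have hsub : (insert a {y | ∃ e ∈ C', y ∈ e})ᶜ ⊆ (insert a {y | ∃ e ∈ C, y ∈ e} : Set V)ᶜ :=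
      compl_subset_compl.2 (insert_subset_insert fun y ⟨e, he, hye⟩ => ⟨e, hCC' he, hye⟩)
    refine measureReal_mono (compl_subset_compl.2 ?_)
    rintro ω ⟨hx, hy, hr⟩
    exact ⟨hsub hx, hsub hy, hr.map (SimpleGraph.induceHomOfLE (G := openGraph ω) hsub).toHom⟩
  have key := BHK2006_clusterConditionalPositiveAssociation_holds V w a {b, c} F G hFm hGm haX
  rw [hDX] at key
  -- value of `F` and `G` on `{C(a) = W}`
  have hFval : ∀ (W : Finset V) ω, ω ∈ clusterIs a W → F (openEdgeCluster ω a) = if x ∈ W then 1 else 0 := by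
    intro W ω hω
    rw [mem_clusterIs] at hω
    have hx : (∃ e ∈ openEdgeCluster ω a, x ∈ e) ↔ x ∈ W := by
      have h1 := reachable_iff_exists_mem_openEdgeCluster ω a x
      have h2 : (openGraph ω).Reachable a x ↔ x ∈ (↑W : Set V) := by rw [← hω]; rfl
      rw [h2] at h1
      constructor
      · intro h; exact Finset.mem_coe.1 (h1.2 (Or.inr h))
      · intro h; rcases h1.1 (Finset.mem_coe.2 h) with h' | h'
        · exact absurd h' hxa
        · exact h'
    simp only [hF, hx]
  have hGval : ∀ (W : Finset V) ω, ω ∈ clusterIs a W →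
      G (openEdgeCluster ω a) = (prodBernoulli w).real (openConnIn ((↑W : Set V)ᶜ) b c)ᶜ := by
    intro W ω hω
    rw [mem_clusterIs] at hω
    simp only [hG, insert_vertices_openEdgeCluster ω a, hω]
  -- the Markov identity on each cluster value, for `b ∉ W`
  have hMarkov : ∀ W ∈ KNGoodAux.nullSets ({b, c} : Finset V),
      (prodBernoulli w).real (openConnIn ((↑W : Set V)ᶜ) b c)ᶜ * (prodBernoulli w).real (clusterIs a W) =
        (prodBernoulli w).real (clusterIs a W ∩ (openConn b c)ᶜ) := by
    intro W hW
    rw [KNGoodAux.mem_nullSets, Finset.disjoint_left] at hW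
    have hbW : b ∉ W := fun h => hW h (by simp)
    have h1 := KNGoodAux.real_clusterIs_inter_openConn w a W hbW c
    have h2 := measureReal_inter_add_sdiff (μ := prodBernoulli w) (s := clusterIs a W)
      (t := (openConn b c : Set (BondConfig V))) MeasurableSet.of_discrete
    have h3 : clusterIs a W \ (openConn b c : Set (BondConfig V)) = clusterIs a W ∩ (openConn b c)ᶜ := rfl
    have h4 : (prodBernoulli w).real (openConnIn ((↑W : Set V)ᶜ) b c)ᶜ =
        1 - (prodBernoulli w).real (openConnIn ((↑W : Set V)ᶜ) b c) :=
      probReal_compl_eq_one_sub MeasurableSet.of_discrete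
    rw [h4, ← h3]
    nlinarith [h1, h2]
  -- the three integrals
  have hIF : ∫ ω in ((openConn a b)ᶜ ∩ (openConn a c)ᶜ : Set (BondConfig V)), F (openEdgeCluster ω a) ∂(prodBernoulli w) =
      (prodBernoulli w).real ((openConn a b)ᶜ ∩ (openConn a c)ᶜ ∩ openConn a x) := by
    have hind : ∀ ω, F (openEdgeCluster ω a) = (openConn a x : Set (BondConfig V)).indicator 1 ω := by
      intro ω
      simp only [hF, indicator, Pi.one_apply]
      have h1 := reachable_iff_exists_mem_openEdgeCluster ω a x
      by_cases hr : (openGraph ω).Reachable a x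
      · rw [if_pos (moc.2 hr), if_pos]
        rcases h1.1 hr with h | h
        · exact absurd h hxa
        · exact h
      · rw [if_neg (fun h => hr (moc.1 h)), if_neg]
        intro h; exact hr (h1.2 (Or.inr h))
    simp_rw [hind]
    rw [integral_indicator_one MeasurableSet.of_discrete, measureReal_restrict_apply MeasurableSet.of_discrete, inter_comm]
  have hIG : ∫ ω in ((openConn a b)ᶜ ∩ (openConn a c)ᶜ : Set (BondConfig V)), G (openEdgeCluster ω a) ∂(prodBernoulli w) =
      (prodBernoulli w).real ((openConn a b)ᶜ ∩ (openConn a c)ᶜ ∩ (openConn b c)ᶜ) := by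
    rw [setIntegral_isoA_eq_sum (prodBernoulli w) a b c _ _ hGval, Finset.sum_congr rfl hMarkov,
      KNGoodAux.sum_real_clusterIs_inter w {b, c} a, hDX']
  have hIFG : ∫ ω in ((openConn a b)ᶜ ∩ (openConn a c)ᶜ : Set (BondConfig V)),
      F (openEdgeCluster ω a) * G (openEdgeCluster ω a) ∂(prodBernoulli w) =
      (prodBernoulli w).real ((openConn a b)ᶜ ∩ (openConn a c)ᶜ ∩ openConn a x ∩ (openConn b c)ᶜ) := by
    rw [setIntegral_isoA_eq_sum (prodBernoulli w) a b c _
      (fun W => (if x ∈ W then 1 else 0) * (prodBernoulli w).real (openConnIn ((↑W : Set V)ᶜ) b c)ᶜ)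
      (fun W ω hω => by rw [hFval W ω hω, hGval W ω hω])]
    have hterm : ∀ W ∈ KNGoodAux.nullSets ({b, c} : Finset V),
        (if x ∈ W then (1 : ℝ) else 0) * (prodBernoulli w).real (openConnIn ((↑W : Set V)ᶜ) b c)ᶜ *
            (prodBernoulli w).real (clusterIs a W) =
          (prodBernoulli w).real (clusterIs a W ∩ (openConn a x ∩ (openConn b c)ᶜ)) := by
      intro W hW
      by_cases hxW : x ∈ W
      · rw [if_pos hxW, one_mul, hMarkov W hW]
        have hset : clusterIs a W ∩ (openConn a x ∩ (openConn b c)ᶜ : Set (BondConfig V)) =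
            clusterIs a W ∩ (openConn b c)ᶜ := by
          ext ω
          constructor
          · rintro ⟨hW', -, hbc⟩; exact ⟨hW', hbc⟩
          · rintro ⟨hW', hbc⟩
            refine ⟨hW', ?_, hbc⟩
            rw [mem_clusterIs] at hW'
            have : x ∈ openCluster ω a := by rw [hW']; exact Finset.mem_coe.2 hxW
            exact this
        rw [hset]
      · rw [if_neg hxW, zero_mul, zero_mul]
        have hset : clusterIs a W ∩ (openConn a x ∩ (openConn b c)ᶜ : Set (BondConfig V)) = ∅ := by
          ext ω
          simp only [mem_inter_iff, mem_empty_iff_false, iff_false, not_and]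
          intro hω hax _
          rw [mem_clusterIs] at hω
          have : x ∈ openCluster ω a := hax
          rw [hω] at this; exact hxW (Finset.mem_coe.1 this)
        rw [hset, measureReal_empty]
    rw [Finset.sum_congr rfl hterm, KNGoodAux.sum_real_clusterIs_inter w {b, c} a, hDX', ← inter_assoc]
  rw [hIF, hIG, hIFG] at key
  exact key

end NC

end Summit.CriticalPhenomena.PercolationContinuityZ3.Theorems.ThreePointIsoSexticEdgeNC
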